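import Mathlib
import Summits.KontsevichZagierPeriods.Zeta5Search.DualSeriesDecomposition
import Literature.NumberTheory.Irrationality.BrownZudilin2022.GeneralFamily
import HarnessLib

/-!
# The wedge-square dictionary for the Brown–Zudilin ζ(5) family: canonical coefficients and the conjecture

Cell `pub-zeta5` (HONEST FRAMING: systematic search; no irrationality claim unless certified), typer seat
generation 3, typing the statements found by the planner seats gen-1/gen-2
(`run/shared/lean/pub/pub-zeta5/pub-zeta5-gen-1/DICTIONARY.md`; Lean staging by gen-1 g2/g3, ported here to the
Literature vocabulary `bOfA`, `vwpDual 7` of `BrownZudilin2022/WellPoisedDual.lean`).  THIS IS NOT LITERATURE: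
`wedgeDictionary` is OUR conjecture (internally minted, verified instances only), hence lives under
`Summits/KontsevichZagierPeriods/Zeta5Search/` and is tagged `@[conjecture]`; nothing here is a cited fact.

Contents (for integer dual parameters `b : ℕ → ℤ`, `b 0 = b₀`, `b j = b_j`):

* CANONICAL COEFFICIENTS.  `IsPFData b c`: `c = (c_{o,p})_{o<6, p≤b₀}` is partial-fraction data of the summand
  `R_b(t) = numPoly_b(t+1)/(t+1)_{b₀+1}^6` of (34) (`DualSeries.term_eq`), i.e.
  `R_b(t) = Σ_{p≤b₀} Σ_{o<6} c_{o,p}/(t+p+1)^{o+1}`; such data are UNIQUE (`IsPFData.eq`, from `BallRivoal.pf_unique`) and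
  EXIST on the box with `Σ_j b_j ≤ 3b₀+1` (`exists_isPFData`, from `CressonFischlerRivoal2008.exists_pf_data`).
  `coeffU b = Σ_p c_{4,p}`, `coeffW b = Σ_p c_{2,p}`, `coeffV b = Σ_{o,p} c_{o,p} H_p^{(o+1)}` (through a choice of
  data, `pfData`; independent of the choice by uniqueness: `coeffU_eq`, `coeffW_eq`, `coeffV_eq`).
* DECOMPOSITION THEOREM (`vwp_decomposition`): on the box with `Σ_j b_j ≤ 3b₀+1`,
  `F̃₇(b) = coeffU b · ζ(5) + coeffW b · ζ(3) − coeffV b` — the coefficients of the cell's dictionary ARE the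
  `ζ(5)`/`ζ(3)`/`1`-coefficients of the very-well-poised series (no linear independence of zeta values is used or
  smuggled: the coefficients are defined by partial fractions, not by the value).
* `dOf b = 3b₀ − Σ_j b_j`, the 15 pairs `Epairs`, and gen-1's closed scalar
  `rhoOf a = (−1)^{Σ_j b_j} ∏_{(j,k)∈E} (b₀−b_j−b_k)! / (4 · b₁! b₄! b₅! b₆! b₇! · d!)` at `b = b(a)`.
* CONJECTURE (`wedgeDictionary`, internally minted; DICTIONARY.md: `Q`-identity exact at 8550 points, `P̂`/`I`
  identities to 1e−29…1e−33 against BZ (15) and 1e−9 against the cellular integral (10)): for convergent `a`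
  with `0 ≤ 2b_i ≤ b₀+1`, `d ≥ 0` and a partner `j` with `2(b_j+1) ≤ b₀+1`, writing `b = b(a)`, `b' = b + e_j`:
  `Q(a) = ρ·(U(b)W(b') − U(b')W(b))` and `I(a) = 2ρ·[(W(b') − 2ζ(2)U(b'))·F̃₇(b) − (W(b) − 2ζ(2)U(b))·F̃₇(b')]`.
  By Lemma 1 (`DualSeries.vwpDual_seven_contiguity'`) the right-hand sides do not depend on the partner `j`
  up to the factor recorded in `ρ` (gen-1: "same `c_n` for all seven `j`").
-/

noncomputable section

open Finset Polynomial

namespace Summit.KontsevichZagierPeriods.Zeta5Search.WedgeDictionary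

open Summit.KontsevichZagierPeriods.Zeta5Search.DualSeries
open Literature.NumberTheory.Irrationality.BrownZudilin2022 (vwpDual bOfA Converges cellularIntegral QOf)
open Literature.NumberTheory.Irrationality.CressonFischlerRivoal2008 (poch exists_pf_data sum_pf_data_odd
  hasSum_of_pf_data)
open Literature.NumberTheory.Transcendental (zetaValue)
open Literature.NumberTheory.Transcendental.BallRivoal (pfEval harm pf_unique pfEval_sub')

/-! ### Canonical partial-fraction coefficients of `F̃₇(b)` -/

/-- `c` is partial-fraction data of the summand `R_b(t) = numPoly_b(t+1)/(t+1)_{b₀+1}^6` of (34):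
`R_b(t) = Σ_{p ≤ b₀} Σ_{o < 6} c_{o,p}/(t+p+1)^{o+1}` away from the poles. -/
def IsPFData (b : ℕ → ℤ) (c : ℕ → ℕ → ℚ) : Prop :=
  ∀ t : ℚ, (∀ p, p ≤ (b 0).toNat → t + p + 1 ≠ 0) →
    pfEval (b 0).toNat 6 c t =
      ((numPoly b).comp (X + C 1)).eval t /
        Literature.NumberTheory.Transcendental.BallRivoal.poch (t + 1) ((b 0).toNat + 1) ^ 6

/-- UNIQUENESS of partial-fraction data on their support (`o < 6`, `p ≤ b₀`). -/
theorem IsPFData.eq {b : ℕ → ℤ} {c c' : ℕ → ℕ → ℚ} (hc : IsPFData b c) (hc' : IsPFData b c')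
    {o p : ℕ} (ho : o < 6) (hp : p ≤ (b 0).toNat) : c o p = c' o p := by
  have h := pf_unique (b 0).toNat 6 (fun o p => c o p - c' o p) 0 (fun t _ => by
    have hpole : ∀ p, p ≤ (b 0).toNat → (t : ℚ) + p + 1 ≠ 0 := fun p _ => by positivity
    rw [pfEval_sub', hc _ hpole, hc' _ hpole, sub_self]) o p ho hp
  exact sub_eq_zero.1 h

open Classical in
/-- A CHOICE of partial-fraction data (junk `0` if none exists; see `exists_isPFData`). -/
def pfData (b : ℕ → ℤ) : ℕ → ℕ → ℚ :=
  if h : ∃ c, IsPFData b c then Classical.choose h else fun _ _ => 0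

/-- The chosen data are partial-fraction data as soon as some exist. -/
theorem isPFData_pfData {b : ℕ → ℤ} {c : ℕ → ℕ → ℚ} (hc : IsPFData b c) : IsPFData b (pfData b) := by
  have h : ∃ c, IsPFData b c := ⟨c, hc⟩
  rw [pfData, dif_pos h]
  exact Classical.choose_spec h

/-- CANONICAL coefficient of `ζ(5)`: `U(b) = Σ_{p ≤ b₀} c_{4,p}`. -/
def coeffU (b : ℕ → ℤ) : ℚ := ∑ p ∈ range ((b 0).toNat + 1), pfData b 4 p

/-- CANONICAL coefficient of `ζ(3)`: `W(b) = Σ_{p ≤ b₀} c_{2,p}`. -/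
def coeffW (b : ℕ → ℤ) : ℚ := ∑ p ∈ range ((b 0).toNat + 1), pfData b 2 p

/-- CANONICAL constant term: `V(b) = Σ_{o<6} Σ_{p ≤ b₀} c_{o,p} · H_p^{(o+1)}` (`H_p^{(i)} = BallRivoal.harm i p`). -/
def coeffV (b : ℕ → ℤ) : ℚ :=
  ∑ o ∈ range 6, ∑ p ∈ range ((b 0).toNat + 1), pfData b o p * harm (o + 1) p

/-- `U(b)` computed from ANY partial-fraction data. -/
theorem coeffU_eq {b : ℕ → ℤ} {c : ℕ → ℕ → ℚ} (hc : IsPFData b c) :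
    coeffU b = ∑ p ∈ range ((b 0).toNat + 1), c 4 p :=
  sum_congr rfl fun p hp => (isPFData_pfData hc).eq hc (by norm_num) (Nat.lt_succ_iff.1 (mem_range.1 hp))

/-- `W(b)` computed from ANY partial-fraction data. -/
theorem coeffW_eq {b : ℕ → ℤ} {c : ℕ → ℕ → ℚ} (hc : IsPFData b c) :
    coeffW b = ∑ p ∈ range ((b 0).toNat + 1), c 2 p :=
  sum_congr rfl fun p hp => (isPFData_pfData hc).eq hc (by norm_num) (Nat.lt_succ_iff.1 (mem_range.1 hp))

/-- `V(b)` computed from ANY partial-fraction data. -/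
theorem coeffV_eq {b : ℕ → ℤ} {c : ℕ → ℕ → ℚ} (hc : IsPFData b c) :
    coeffV b = ∑ o ∈ range 6, ∑ p ∈ range ((b 0).toNat + 1), c o p * harm (o + 1) p :=
  sum_congr rfl fun o ho => sum_congr rfl fun p hp => by
    rw [(isPFData_pfData hc).eq hc (mem_range.1 ho) (Nat.lt_succ_iff.1 (mem_range.1 hp))]

/-! ### Existence of the data and the decomposition `F̃₇(b) = Uζ(5) + Wζ(3) − V` -/

/-- The degree hypothesis of Cresson–Fischler–Rivoal (`A = 6`, `n = b₀`) on the box with `Σ_j b_j ≤ 3b₀ + 1`. -/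
theorem natDegree_numPoly_add_two_le (b : ℕ → ℤ) (hb : InBox b)
    (hsum : ∑ j ∈ range 7, b (j + 1) ≤ 3 * b 0 + 1) :
    (numPoly b).natDegree + 2 ≤ 6 * ((b 0).toNat + 1) := by
  obtain ⟨h0, hj⟩ := hb
  have hb0 : (b 0 : ℤ) = ((b 0).toNat : ℤ) := (Int.toNat_of_nonneg h0).symm
  have hS : ∑ j ∈ range 7, b (j + 1) = ((∑ j ∈ range 7, (b (j + 1)).toNat : ℕ) : ℤ) := by
    rw [Nat.cast_sum]
    exact sum_congr rfl fun j hj' => (Int.toNat_of_nonneg (hj j hj').1).symm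
  have h1 := natDegree_numPoly_le b
  have h2 : ((∑ j ∈ range 7, (b (j + 1)).toNat : ℕ) : ℤ) ≤ 3 * ((b 0).toNat : ℤ) + 1 := by
    rw [← hS, ← hb0]; exact hsum
  omega

/-- EXISTENCE of partial-fraction data on the box with `Σ_j b_j ≤ 3b₀ + 1`
(`CressonFischlerRivoal2008.exists_pf_data`). -/
theorem exists_isPFData (b : ℕ → ℤ) (hb : InBox b) (hsum : ∑ j ∈ range 7, b (j + 1) ≤ 3 * b 0 + 1) :
    ∃ c, IsPFData b c := by
  have hdeg := natDegree_numPoly_add_two_le b hb hsum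
  have hQ : ((numPoly b).comp (X + C 1)).degree < ((6 * ((b 0).toNat + 1) : ℕ) : WithBot ℕ) := by
    have hnat : ((numPoly b).comp (X + C 1)).natDegree = (numPoly b).natDegree := by
      rw [natDegree_comp, natDegree_X_add_C, mul_one]
    exact degree_le_natDegree.trans_lt (by rw [hnat]; exact_mod_cast (by omega))
  exact exists_pf_data (b 0).toNat 6 (by norm_num) _ hQ

/-- The series (34) summed through partial-fraction data: for ANY data `c` of `R_b`,
`Σ_μ term b μ = (Σ_p c_{4,p}) ζ(5) + (Σ_p c_{2,p}) ζ(3) − Σ_{o,p} c_{o,p} H_p^{(o+1)}` — Cresson–Fischler–Rivoal's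
Théorème 1 with explicit coefficients (`hasSum_of_pf_data`: the coefficients of `ζ(2), ζ(4), ζ(6)` vanish by
the well-poised reflection `numPoly_reflect`, and there is no `H^{(1)}`-term). -/
theorem hasSum_term_pf (b : ℕ → ℤ) (hb : InBox b) (hsum : ∑ j ∈ range 7, b (j + 1) ≤ 3 * b 0 + 1)
    {c : ℕ → ℕ → ℚ} (hc : IsPFData b c) :
    HasSum (term b)
      ((∑ p ∈ range ((b 0).toNat + 1), (c 4 p : ℝ)) * zetaValue 5 +
        (∑ p ∈ range ((b 0).toNat + 1), (c 2 p : ℝ)) * zetaValue 3 -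
        ∑ o ∈ range 6, ∑ p ∈ range ((b 0).toNat + 1), (c o p : ℝ) * (harm (o + 1) p : ℝ)) := by
  have hdeg := natDegree_numPoly_add_two_le b hb hsum
  have hS := hasSum_of_pf_data (b 0).toNat 6 (numPoly b) (by norm_num) hdeg (numPoly_reflect b hb) c hc
  have hfun : term b = fun k : ℕ => aeval ((k : ℝ) + 1) (numPoly b) / poch (k + 1) (b 0).toNat ^ 6 :=
    funext fun k => term_eq b hb k
  rw [hfun]
  convert hS using 1
  rw [filter_odd_Icc_three_six, sum_pair (by norm_num)]
  simp only [Nat.reduceSub]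
  ring

/-- The odd orders carry nothing: `Σ_p c_{o,p} = 0` for `o ∈ {1, 3, 5}` (coefficients of `ζ(2), ζ(4), ζ(6)`). -/
theorem sum_pfData_odd (b : ℕ → ℤ) (hb : InBox b) {c : ℕ → ℕ → ℚ} (hc : IsPFData b c)
    {o : ℕ} (ho : o < 6) (hodd : Odd o) : ∑ p ∈ range ((b 0).toNat + 1), c o p = 0 :=
  sum_pf_data_odd (b 0).toNat 6 (numPoly b) (numPoly_reflect b hb) c hc o ho hodd

/-- **DECOMPOSITION with the canonical coefficients** (THEOREM, not a conjecture): on the box with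
`Σ_j b_j ≤ 3b₀ + 1`, the series (34) converges to `U(b)ζ(5) + W(b)ζ(3) − V(b)` and
`F̃₇(b) = vwpDual 7 b = U(b)·ζ(5) + W(b)·ζ(3) − V(b)`. -/
theorem vwp_decomposition (b : ℕ → ℤ) (hb : InBox b) (hsum : ∑ j ∈ range 7, b (j + 1) ≤ 3 * b 0 + 1) :
    HasSum (term b) ((coeffU b : ℝ) * zetaValue 5 + (coeffW b : ℝ) * zetaValue 3 - (coeffV b : ℝ)) ∧
      vwpDual 7 b = (coeffU b : ℝ) * zetaValue 5 + (coeffW b : ℝ) * zetaValue 3 - (coeffV b : ℝ) := by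
  obtain ⟨c, hc⟩ := exists_isPFData b hb hsum
  have h := hasSum_term_pf b hb hsum hc
  rw [coeffU_eq hc, coeffW_eq hc, coeffV_eq hc]
  push_cast
  exact ⟨h, by rw [vwpDual_seven_eq_tsum, h.tsum_eq]⟩


/-! ### Coefficients in the conjecture's region are THE coefficients of `F̃₇` -/

/-- In the region of the conjecture (`0 ≤ b₀`, `0 ≤ 2b_i ≤ b₀ + 1`, `d(b) ≥ −1`) the decomposition theorem applies:
`F̃₇(b) = U(b)ζ(5) + W(b)ζ(3) − V(b)`. -/
theorem vwpDual_seven_eq_of_region (b : ℕ → ℤ) (h0 : 0 ≤ b 0)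
    (hb : ∀ j ∈ range 7, 0 ≤ b (j + 1) ∧ 2 * b (j + 1) ≤ b 0 + 1)
    (hsum : ∑ j ∈ range 7, b (j + 1) ≤ 3 * b 0 + 1) :
    vwpDual 7 b = (coeffU b : ℝ) * zetaValue 5 + (coeffW b : ℝ) * zetaValue 3 - (coeffV b : ℝ) :=
  (vwp_decomposition b ⟨h0, fun j hj => ⟨(hb j hj).1, by linarith [(hb j hj).1, (hb j hj).2]⟩⟩ hsum).2

/-! ### The closed scalar `ρ(a)` of gen-1 and the conjecture -/

/-- `d(b) = 3b₀ − Σ_{j=1}^{7} b_j` (at `b = b(a)` this is `a₁+a₅+a₇+a₈−a₂−a₃`, the extra `G`-invariant form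
after (26) of arXiv:2210.03391; `d ≥ −1` is the convergence condition of (34), `dOf_bOfA`). -/
def dOf (b : ℕ → ℤ) : ℤ := 3 * b 0 - ∑ j ∈ range 7, b (j + 1)

/-- At `b = b(a)`: `d = a₁ + a₅ + a₇ + a₈ − a₂ − a₃` (with `a : Fin 8 → ℤ`, `a 0 = a₁`). -/
theorem dOf_bOfA (a : Fin 8 → ℤ) : dOf (bOfA a) = a 0 + a 4 + a 6 + a 7 - a 1 - a 2 := by
  simp only [dOf, bOfA, sum_range_succ, sum_range_zero]
  ring

/-- The 15 pairs `E = {12,13,14,15,23,24,25,26,34,36,37,47,56,57,67}` (all pairs from `{1,…,7}` except the six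
`16,17,27,35,45,46` appearing in (35)). -/
def Epairs : List (ℕ × ℕ) :=
  [(1,2),(1,3),(1,4),(1,5),(2,3),(2,4),(2,5),(2,6),(3,4),(3,6),(3,7),(4,7),(5,6),(5,7),(6,7)]

/-- gen-1's CLOSED SCALAR (found by computation, two independent implementations, DICTIONARY.md §(b)):
`ρ(a) = (−1)^{Σ_j b_j} ∏_{(j,k)∈E} (b₀−b_j−b_k)! / (4 · b₁! b₄! b₅! b₆! b₇! · d!)` at `b = b(a)` (factorials of
the integer arguments through `Int.toNat`; meaningful in the conjecture's region). -/
def rhoOf (a : Fin 8 → ℤ) : ℚ :=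
  let b := bOfA a
  (-1 : ℚ) ^ (∑ j ∈ range 7, b (j + 1)).toNat *
      ((Epairs.map fun jk => ((b 0 - b jk.1 - b jk.2).toNat.factorial : ℚ)).prod) /
    (4 * (([1, 4, 5, 6, 7] : List ℕ).map fun j => ((b j).toNat.factorial : ℚ)).prod *
      ((dOf b).toNat.factorial : ℚ))

/-- **CONJECTURE (the wedge-square dictionary; INTERNALLY MINTED — verified instances only, DICTIONARY.md).**
For `a` in the convergence cone of the cellular integral with dual parameters `b = b(a)` satisfying
`0 ≤ 2b_i ≤ b₀ + 1` (`i = 1,…,7`) and `d(b) ≥ 0`, and any partner index `j ∈ [1,7]` with `2(b_j + 1) ≤ b₀ + 1`,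
writing `b' = b + e_j`, `ρ = rhoOf a`, `U, W` the CANONICAL `ζ(5)`/`ζ(3)`-coefficients of `F̃₇` (`coeffU`, `coeffW`;
by `vwpDual_seven_eq_of_region` they are the coefficients in `F̃₇ = Uζ(5) + Wζ(3) − V` at both `b` and `b'`):

* (ζ-free part) `Q(a) = ρ · (U(b) W(b') − U(b') W(b))` — the leading coefficient (17) of Brown–Zudilin is a
  2×2 minor ("wedge square") of the coefficient vectors of two contiguous very-well-poised series;
* (the integral) `I(a) = 2ρ · [(W(b') − 2ζ(2) U(b')) · F̃₇(b) − (W(b) − 2ζ(2) U(b)) · F̃₇(b')]`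
  (equivalently `P̂ = ρ(UV' − U'V)`, `P = ρ(W'V − WV')` in the decomposition (4)).

Evidence (not proof): `Q`-identity exact at 8550 lattice points, 0 failures; the `I`-identity to 1e−29…1e−33
against BZ (15) and 1e−9…1e−11 against the 5-fold cellular integral (10); reduces to Zudilin 2002 (15) at
`a = 1⁸`.  By Lemma 1 (`DualSeries.vwpDual_seven_contiguity'`) the partner-dependence is as recorded. -/
@[conjecture] def wedgeDictionary : Prop :=
  ∀ (a : Fin 8 → ℤ) (j : ℕ), j ∈ Icc 1 7 → Converges a →
    (∀ i ∈ Icc 1 7, 0 ≤ bOfA a i ∧ 2 * bOfA a i ≤ bOfA a 0 + 1) → 0 ≤ dOf (bOfA a) →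
    2 * (bOfA a j + 1) ≤ bOfA a 0 + 1 →
    let b := bOfA a
    let b' := Function.update b j (b j + 1)
    (QOf a : ℚ) = rhoOf a * (coeffU b * coeffW b' - coeffU b' * coeffW b) ∧
    cellularIntegral a =
      2 * (rhoOf a : ℝ) *
        (((coeffW b' : ℝ) - 2 * zetaValue 2 * coeffU b') * vwpDual 7 b -
          ((coeffW b : ℝ) - 2 * zetaValue 2 * coeffU b) * vwpDual 7 b')

/-! ### Sanity checks of the closed scalar (values found by computation, gen-1) -/

example : dOf (bOfA ![1, 1, 1, 1, 1, 1, 1, 1]) = 2 := by decide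
example : rhoOf ![1, 1, 1, 1, 1, 1, 1, 1] = -1 / 8 := by decide +kernel
example : rhoOf ![2, 1, 1, 1, 1, 1, 1, 1] = 2 / 3 := by decide +kernel

end Summit.KontsevichZagierPeriods.Zeta5Search.WedgeDictionary
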